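import Summits.KontsevichZagierPeriods.KontsevichZagierPeriods.Theorems.TerasomaMultiplicationGammaHodgeSectorDefs

/-!
# `GammaHodgeSector` (stmt-KontsevichZagierPeriods-3742), line `koblitz-ogus-halving`:
# stub `stub_kernel`

The BETA SYZYGY THEOREM in the free Beta symbol group `BSym = ℤ[ℚ × ℚ]` of
`Literature.NumberTheory.Transcendental.BetaSymbolGroup`: a level-`D` symbol combination with
vanishing class vector `clD D` lies in the span `RelSpan` of the standard relators — in fact in the
span of the level-`D` translations `[a,b] − [a+1,b]` and Dirichlet re-associations
`[a,b] + [a+b,c] − [b,c] − [a,b+c]` (normal form by `D` normal symbols `[(r+1)/D, 1/D]` and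
injectivity of the class vector on normal forms). Pure algebra over Mathlib; no analysis.
-/

noncomputable section

open MeasureTheory Set
open scoped BigOperators

namespace Summit.KontsevichZagierPeriods.GammaHodgeSectorKO

open Literature.NumberTheory.Transcendental Literature.NumberTheory.Transcendental.KZ
  Literature.NumberTheory.Transcendental.BetaSymbol

/-! ## Stub `stub_kernel`: the Beta syzygy theorem

A level-`D` element of the Beta symbol group with vanishing class vector lies in `RelSpan`.
Proof: in integer coordinates `a = i/D`, every level-`D` symbol `[i/D, j/D]` is congruent, modulo
level-`D` translations `[a,b] − [a+1,b]` and Dirichlet re-associations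
`[a,b] + [a+b,c] − [b,c] − [a,b+c]` (both in `RelSpan` and both with zero class vector), to an
integral combination of the `D` NORMAL SYMBOLS `[(r+1)/D, 1/D]`, `r = 0, …, D−1` (re-association
with `c = 1/D` lowers the second coordinate, translation reduces the first one modulo `D`); and the
class vector is injective on such combinations (`Σ_r c_r (e_{r+1} + e_1 − e_{r+2}) = 0` forces `c`
to be constant and then `D · c = 0`). -/

section Kernel

variable (D : ℕ) [NeZero D]

omit [NeZero D] in
/-- `i/D + j/D = (i+j)/D`. [folklore] -/
private theorem natDiv_add (i j : ℕ) : (i : ℚ) / D + (j : ℚ) / D = ((i + j : ℕ) : ℚ) / D := by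
  push_cast; ring

/-- The class of `k/D` in `ℤ/D` is `k`. [folklore] -/
private theorem toZMod_natDiv (k : ℕ) : toZMod D ((k : ℚ) / D) = (k : ZMod D) := by
  have hD : (D : ℚ) ≠ 0 := Nat.cast_ne_zero.mpr (NeZero.ne D)
  rw [toZMod, div_mul_cancel₀ _ hD, Rat.num_natCast, Int.cast_natCast]

/-- The class vector of the symbol `[i/D, j/D]`: `e_i + e_j − e_{i+j}`. [folklore] -/
private theorem clD_bsym_natDiv {a b : ℚ} {i j : ℕ} (ha : a = (i : ℚ) / D) (hb : b = (j : ℚ) / D) :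
    clD D (bsym a b) = fun x => (if x = (i : ZMod D) then 1 else 0) +
      (if x = (j : ZMod D) then 1 else 0) - (if x = ((i + j : ℕ) : ZMod D) then 1 else 0) := by
  subst ha hb
  rw [clD_bsym, natDiv_add]
  funext x
  simp only [Pi.add_apply, Pi.sub_apply, eZ, toZMod_natDiv]

/-- `i/D` is of level `D` for `1 ≤ i`. [folklore] -/
private theorem isLevel_natDiv {i : ℕ} (hi : 1 ≤ i) : IsLevel D ((i : ℚ) / D) := by
  have hD : (0 : ℚ) < D := Nat.cast_pos.mpr (Nat.pos_of_neZero D)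
  refine ⟨div_pos (by exact_mod_cast hi) hD, ?_⟩
  rw [div_mul_cancel₀ _ hD.ne', Rat.den_natCast]

/-- A level-`D` rational is `i/D` with `1 ≤ i`. [folklore] -/
private theorem exists_eq_natDiv_of_isLevel {a : ℚ} (ha : IsLevel D a) :
    ∃ i : ℕ, 1 ≤ i ∧ a = (i : ℚ) / D := by
  obtain ⟨hpos, hden⟩ := ha
  have hD : (0 : ℚ) < D := Nat.cast_pos.mpr (Nat.pos_of_neZero D)
  have hnum : ((a * D).num : ℚ) = a * D := Rat.coe_int_num_of_den_eq_one hden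
  have hnum_pos : 0 < (a * D).num := Rat.num_pos.mpr (mul_pos hpos hD)
  refine ⟨(a * D).num.toNat, by omega, ?_⟩
  have hcast : (((a * D).num.toNat : ℕ) : ℚ) = ((a * D).num : ℚ) := by
    exact_mod_cast Int.toNat_of_nonneg hnum_pos.le
  rw [hcast, hnum, mul_div_cancel_right₀ _ hD.ne']

/-- Translation `[a,b] − [a+1,b] ∈ RelSpan` (Andrews–Askey–Roy, Thm 1.8.1). [folklore] -/
private theorem translation_mem_relSpan {a b : ℚ} (ha : 0 < a) (hb : 0 < b) :
    bsym a b - bsym (a + 1) b ∈ RelSpan := by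
  have h : (({(a, b)} : Multiset (ℚ × ℚ)), ({(a + 1, b)} : Multiset (ℚ × ℚ))) ∈ relatorPairs :=
    Or.inl <| Or.inl <| Or.inl <| Or.inl <| Or.inr ⟨a, b, ha, hb, rfl⟩
  simpa using sub_mem_relSpan h

/-- Dirichlet re-association `[a,b] + [a+b,c] − [b,c] − [a,b+c] ∈ RelSpan` (Andrews–Askey–Roy,
Thm 1.8.1). [folklore] -/
private theorem dirichlet_mem_relSpan {a b c : ℚ} (ha : 0 < a) (hb : 0 < b) (hc : 0 < c) :
    bsym a b + bsym (a + b) c - bsym b c - bsym a (b + c) ∈ RelSpan := by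
  have h : (({(a, b), (a + b, c)} : Multiset (ℚ × ℚ)), ({(b, c), (a, b + c)} : Multiset (ℚ × ℚ)))
      ∈ relatorPairs :=
    Or.inl <| Or.inl <| Or.inl <| Or.inr ⟨a, b, c, ha, hb, hc, rfl⟩
  have h' := sub_mem_relSpan h
  simp only [Multiset.insert_eq_cons, msym_cons, msym_singleton] at h'
  convert h' using 1
  abel

omit [NeZero D] in
/-- A Dirichlet re-association has zero class vector. [folklore] -/
private theorem clD_dirichlet (a b c : ℚ) :
    clD D (bsym a b + bsym (a + b) c - bsym b c - bsym a (b + c)) = 0 := by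
  simp only [map_add, map_sub, clD_bsym, add_assoc]
  abel

/-- A level-`D` translation has zero class vector. [folklore] -/
private theorem clD_translation (i j : ℕ) :
    clD D (bsym ((i : ℚ) / D) ((j : ℚ) / D) - bsym ((i : ℚ) / D + 1) ((j : ℚ) / D)) = 0 := by
  have hD : (D : ℚ) ≠ 0 := Nat.cast_ne_zero.mpr (NeZero.ne D)
  have e : (i : ℚ) / D + 1 = ((i + D : ℕ) : ℚ) / D := by
    push_cast; field_simp
  rw [map_sub, clD_bsym_natDiv D rfl rfl, clD_bsym_natDiv D e rfl]
  funext x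
  simp

/-- Level-`D` translations lie in `RelSpan ⊓ ker clD`. [folklore] -/
private theorem translation_mem {a b : ℚ} {i j : ℕ} (ha : a = (i : ℚ) / D) (hb : b = (j : ℚ) / D)
    (hi : 1 ≤ i) (hj : 1 ≤ j) : bsym a b - bsym (a + 1) b ∈ RelSpan ⊓ (clD D).ker := by
  subst ha hb
  exact AddSubgroup.mem_inf.mpr ⟨translation_mem_relSpan (isLevel_natDiv D hi).1
    (isLevel_natDiv D hj).1, (AddMonoidHom.mem_ker).mpr (clD_translation D i j)⟩

/-- Level-`D` Dirichlet re-associations lie in `RelSpan ⊓ ker clD`. [folklore] -/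
private theorem dirichlet_mem {a b c : ℚ} {i j l : ℕ} (ha : a = (i : ℚ) / D) (hb : b = (j : ℚ) / D)
    (hc : c = (l : ℚ) / D) (hi : 1 ≤ i) (hj : 1 ≤ j) (hl : 1 ≤ l) :
    bsym a b + bsym (a + b) c - bsym b c - bsym a (b + c) ∈ RelSpan ⊓ (clD D).ker := by
  subst ha hb hc
  exact AddSubgroup.mem_inf.mpr ⟨dirichlet_mem_relSpan (isLevel_natDiv D hi).1
    (isLevel_natDiv D hj).1 (isLevel_natDiv D hl).1,
    (AddMonoidHom.mem_ker).mpr (clD_dirichlet D _ _ _)⟩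

/-- Normal form of `[m/D, 1/D]` (`1 ≤ m`): a single normal symbol, modulo level-`D` translations.
[folklore] -/
private theorem nf_base {m : ℕ} (hm : 1 ≤ m) : ∃ c : ZMod D → ℤ,
    bsym ((m : ℚ) / D) (1 / D) -
      ∑ x : ZMod D, c x • bsym (((x.val + 1 : ℕ) : ℚ) / D) (1 / D) ∈ RelSpan ⊓ (clD D).ker := by
  induction m using Nat.strong_induction_on with
  | _ m ih =>
  by_cases hmD : m ≤ D
  · refine ⟨fun x => if x = ((m - 1 : ℕ) : ZMod D) then 1 else 0, ?_⟩
    have hval : ((m - 1 : ℕ) : ZMod D).val = m - 1 := ZMod.val_cast_of_lt (by omega)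
    simp only [ite_smul, one_smul, zero_smul, Finset.sum_ite_eq', Finset.mem_univ, if_true, hval,
      Nat.sub_add_cancel hm, sub_self]
    exact zero_mem _
  · rw [not_le] at hmD
    have hD1 : 1 ≤ D := Nat.pos_of_neZero D
    have h1 : 1 ≤ m - D := by omega
    obtain ⟨c, hc⟩ := ih (m - D) (by omega) h1
    have h1D : (1 : ℚ) / D = ((1 : ℕ) : ℚ) / D := by rw [Nat.cast_one]
    have hT := translation_mem D (rfl : ((m - D : ℕ) : ℚ) / D = _) h1D h1 le_rfl
    have e : ((m - D : ℕ) : ℚ) / D + 1 = (m : ℚ) / D := by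
      have hD : (D : ℚ) ≠ 0 := Nat.cast_ne_zero.mpr (NeZero.ne D)
      rw [Nat.cast_sub hmD.le]
      field_simp
      ring
    rw [e] at hT
    refine ⟨c, ?_⟩
    convert sub_mem hc hT using 1
    abel

/-- Normal form of `[i/D, j/D]` (`1 ≤ i, j`) modulo level-`D` translations and re-associations.
[folklore] -/
private theorem nf_gen {i : ℕ} (hi : 1 ≤ i) {j : ℕ} (hj : 1 ≤ j) : ∃ c : ZMod D → ℤ,
    bsym ((i : ℚ) / D) ((j : ℚ) / D) -
      ∑ x : ZMod D, c x • bsym (((x.val + 1 : ℕ) : ℚ) / D) (1 / D) ∈ RelSpan ⊓ (clD D).ker := by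
  induction j, hj using Nat.le_induction with
  | base => simpa only [Nat.cast_one] using nf_base D hi
  | succ j hj ih =>
    obtain ⟨c₁, h₁⟩ := ih
    obtain ⟨c₂, h₂⟩ := nf_base D (show 1 ≤ i + j by omega)
    obtain ⟨c₃, h₃⟩ := nf_base D hj
    have h1D : (1 : ℚ) / D = ((1 : ℕ) : ℚ) / D := by rw [Nat.cast_one]
    have hΔ := dirichlet_mem D (rfl : (i : ℚ) / D = _) (rfl : (j : ℚ) / D = _) h1D hi hj le_rfl
    have e : (j : ℚ) / D + 1 / D = ((j + 1 : ℕ) : ℚ) / D := by push_cast; ring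
    rw [natDiv_add, e] at hΔ
    refine ⟨c₁ + c₂ - c₃, ?_⟩
    convert sub_mem (sub_mem (add_mem h₁ h₂) h₃) hΔ using 1
    simp only [Pi.add_apply, Pi.sub_apply, add_smul, sub_smul, Finset.sum_add_distrib,
      Finset.sum_sub_distrib]
    abel

/-- Normal form of a level-`D` element modulo `RelSpan ⊓ ker clD`. [folklore] -/
private theorem nf_all {v : BSym} (hv : v ∈ levelSym D) : ∃ c : ZMod D → ℤ,
    v - ∑ x : ZMod D, c x • bsym (((x.val + 1 : ℕ) : ℚ) / D) (1 / D) ∈ RelSpan ⊓ (clD D).ker := by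
  unfold levelSym at hv
  induction hv using AddSubgroup.closure_induction with
  | mem w hw =>
    obtain ⟨a, b, ha, hb, rfl⟩ := hw
    obtain ⟨i, hi, rfl⟩ := exists_eq_natDiv_of_isLevel D ha
    obtain ⟨j, hj, rfl⟩ := exists_eq_natDiv_of_isLevel D hb
    exact nf_gen D hi hj
  | zero =>
    refine ⟨0, ?_⟩
    simp only [Pi.zero_apply, zero_smul, Finset.sum_const_zero, sub_zero]
    exact zero_mem _
  | add w w' _ _ h h' =>
    obtain ⟨c, hc⟩ := h
    obtain ⟨c', hc'⟩ := h'
    refine ⟨c + c', ?_⟩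
    convert add_mem hc hc' using 1
    simp only [Pi.add_apply, add_smul, Finset.sum_add_distrib]
    abel
  | neg w _ h =>
    obtain ⟨c, hc⟩ := h
    refine ⟨-c, ?_⟩
    convert neg_mem hc using 1
    simp only [Pi.neg_apply, neg_smul, Finset.sum_neg_distrib]
    abel

/-- `Σ_x [y = x + a] c x = c (y − a)`. [folklore] -/
private theorem sum_ite_eq_add_right (c : ZMod D → ℤ) (y a : ZMod D) :
    (∑ x : ZMod D, if y = x + a then c x else 0) = c (y - a) := by
  rw [Finset.sum_eq_single (y - a)]
  · rw [if_pos (sub_add_cancel y a).symm]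
  · intro x _ hx
    rw [if_neg]
    intro hyx
    apply hx
    rw [hyx, add_sub_cancel_right]
  · intro h
    exact absurd (Finset.mem_univ _) h

/-- The class vector is injective on normal forms: if `Σ_x c_x (e_{x+1} + e_1 − e_{x+2}) = 0` on
`ℤ/D` then `c = 0`. [folklore] -/
private theorem nf_injective (c : ZMod D → ℤ)
    (h : clD D (∑ x : ZMod D, c x • bsym (((x.val + 1 : ℕ) : ℚ) / D) (1 / D)) = 0) : c = 0 := by
  have h1D : (1 : ℚ) / D = ((1 : ℕ) : ℚ) / D := by rw [Nat.cast_one]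
  have hcl : ∀ x : ZMod D, clD D (bsym (((x.val + 1 : ℕ) : ℚ) / D) (1 / D)) =
      fun y => (if y = x + 1 then 1 else 0) + (if y = 1 then 1 else 0) -
        (if y = x + (1 + 1) then 1 else 0) := by
    intro x
    rw [clD_bsym_natDiv D rfl h1D]
    simp only [Nat.cast_add, Nat.cast_one, ZMod.natCast_zmod_val, add_assoc]
  simp only [map_sum, map_zsmul, hcl] at h
  have hev : ∀ y : ZMod D,
      c (y - 1) + (if y = 1 then ∑ x : ZMod D, c x else 0) - c (y - (1 + 1)) = 0 := by
    intro y
    have hy := congrFun h y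
    simp only [Finset.sum_apply, Pi.smul_apply, smul_eq_mul, Pi.zero_apply, mul_add, mul_sub,
      Finset.sum_add_distrib, Finset.sum_sub_distrib, mul_ite, mul_one, mul_zero] at hy
    rw [sum_ite_eq_add_right, sum_ite_eq_add_right] at hy
    have hmid : (∑ x : ZMod D, if y = 1 then c x else 0) =
        if y = 1 then ∑ x : ZMod D, c x else 0 := by
      split_ifs <;> simp
    rwa [hmid] at hy
  have hstep : ∀ z : ZMod D, z ≠ 0 → c z = c (z - 1) := by
    intro z hz
    have h' := hev (z + 1)
    rwa [if_neg (fun h'' => hz (by simpa using h'')), add_zero, add_sub_cancel_right,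
      add_sub_add_right_eq_sub, sub_eq_zero] at h'
  have hconst : ∀ k : ℕ, k < D → c (k : ZMod D) = c 0 := by
    intro k
    induction k with
    | zero => intro; rw [Nat.cast_zero]
    | succ k ih =>
      intro hk
      have hne : ((k + 1 : ℕ) : ZMod D) ≠ 0 := by
        rw [Ne, ZMod.natCast_eq_zero_iff]
        exact Nat.not_dvd_of_pos_of_lt (Nat.succ_pos k) hk
      rw [hstep _ hne, Nat.cast_succ, add_sub_cancel_right]
      exact ih (Nat.lt_of_succ_lt hk)
  have hall : ∀ y : ZMod D, c y = c 0 := fun y => by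
    rw [← ZMod.natCast_zmod_val y]
    exact hconst _ (ZMod.val_lt y)
  have hone := hev 1
  rw [if_pos rfl, Finset.sum_congr rfl (fun x _ => hall x), Finset.sum_const, Finset.card_univ,
    ZMod.card, hall (1 - 1), hall (1 - (1 + 1)), nsmul_eq_mul] at hone
  have hmul : (D : ℤ) * c 0 = 0 := by linear_combination hone
  have hc0 : c 0 = 0 :=
    (mul_eq_zero.mp hmul).resolve_left (by exact_mod_cast (NeZero.ne D))
  funext y
  rw [hall y, hc0]
  rfl

end Kernel

/-- STUB (kernel). A level-`D` element of the Beta symbol group with vanishing class vector lies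
in the span of the standard relators (translation + Dirichlet re-association: Beta syzygies are
generated by the symmetric-cocycle relations). [folklore] -/
theorem stub_kernel (D : ℕ) [NeZero D] (v : BSym) (hv : v ∈ levelSym D) (h0 : clD D v = 0) :
    v ∈ RelSpan := by
  obtain ⟨c, hc⟩ := nf_all D hv
  obtain ⟨hrel, hker⟩ := AddSubgroup.mem_inf.mp hc
  rw [AddMonoidHom.mem_ker, map_sub, h0, zero_sub, neg_eq_zero] at hker
  have hc0 : c = 0 := nf_injective D c hker
  subst hc0
  simpa using hrel

end Summit.KontsevichZagierPeriods.GammaHodgeSectorKO
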